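import Literature.Probability.LatticeModels.CurrentExplorationWeights
import Literature.Probability.LatticeModels.RestrictedCorrelationMonotone
import HarnessLib

/-!
# Connection through the depleted graph by a depleted sourceless current plus a full one: `P ≤ ⟨σ_vσ_w⟩⟨σ_vσ_w⟩' ≤ ⟨σ_vσ_w⟩²` (Aizenman–Duminil-Copin 2021, Lemma 4.4, bound on `F₂`)

Topic `Literature/Probability/LatticeModels`. In the proof of the intersection property,

* M. Aizenman, H. Duminil-Copin, *Marginal triviality of the scaling limits of critical 4D Ising and
  `φ⁴₄` models*, Ann. of Math. **194** (2021), arXiv:1912.07973 [AizenmanDuminilCopinAnnals2021],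
  proof of **Lemma 4.4**, bound on `F₂` (p. 12; used again for Lemma 6.2, p. 21): "To bound the
  probability of `F₂`, condition on `Γ(n₁)`. The remaining current in `n₁` is a sourceless current with
  depleted coupling constants … The probability that some `v ∈ ∂Λ_n` and `w ∈ ∂Λ_m` are connected in
  `ℤ⁴ ∖ Γ(n₁)` to each other can then be bounded by `⟨σ_vσ_w⟩⟨σ_vσ_w⟩'` where the `⟨·⟩'` denotes an
  Ising measure with depleted coupling constants (the depletion depends on `Γ(n₁)` and the switching
  lemma concerns one current with depletion and one without; we refer to [AizDumSid15] …). The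
  Griffiths inequality [Gri67] implies that this probability is bounded by `⟨σ_vσ_w⟩²`, which …
  leads to `P^{0x,∅}[F₂] ≤ ∑_{v ∈ ∂Λ_n, w ∈ ∂Λ_m} ⟨σ_vσ_w⟩²`",

the ingredient is the switching lemma with one current living on a subgraph (the nested form of
Aizenman–Duminil-Copin–Sidoravicius 2015, Lemma 2.2; in the tree `Current.etsum_switching_univ`,
`WeightedCurrentsSwitching.lean`). This file draws the stated consequence, in finite volume and
un-normalised current-sum form, for edge couplings `K ≥ 0` on a finite simple graph `G` and any graph
`G₁` on the same vertices (the depleted graph; `Z_{G₁}[A] = ecurrentSumIn G₁ K A`, the connection event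
`x ↔ y` through edges of `G₁` carrying positive total current = `Current.connIn G₁ x y`):

* `Current.tsum_isSupp_empty_empty_connIn_eq` — **the identity**
  `∑ 1{n₁ ⊆ E(G₁), ∂n₁ = ∅} 1{∂n₂ = ∅} w w 𝟙[x ↔ y in E(G₁) through n₁+n₂] = Z_{G₁}[{x,y}] · Z[{x,y}]`,
  i.e. `P^{∅}_{G₁} ⊗ P^{∅}_{G}[x ↔ y in G₁] = ⟨σ_xσ_y⟩'⟨σ_xσ_y⟩` (switching with `A = B = ∅`);
* `ecurrentSumIn_mul_ecurrentSum_empty_le` — Griffiths `Z_{G₁}[A] Z[∅] ≤ Z[A] Z_{G₁}[∅]` for a general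
  subgraph-supported sum (`⟨σ_A⟩' ≤ ⟨σ_A⟩`), through the couplings `K off (E ∖ E(G₁))`;
* `Current.tsum_isSupp_empty_empty_connIn_mul_le` — **the bound** `(…) · Z[∅] ≤ Z[{x,y}]² · Z_{G₁}[∅]`,
  i.e. `P ≤ ⟨σ_xσ_y⟩²`; and its union-bound form over two vertex sets
  (`Current.tsum_isSupp_empty_empty_crossIn_mul_le`): `P[A ↔ B in G₁] ≤ ∑_{a ∈ A, b ∈ B} ⟨σ_aσ_b⟩²`.

No named fact is introduced; everything is proved. Which subgraph `G₁` the conditioning on the backbone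
produces (the bonds not used by the walk, cf. `CurrentExplorationWeights.lean`: a current vanishing on
the used bonds `D` is one supported on `G` with the bonds of `D` deleted, `Current.isSupp_deleteEdges_iff'`)
is left to the user.

## References

* M. Aizenman, H. Duminil-Copin, Ann. of Math. 194 (2021), arXiv:1912.07973, §4.2, proof of Lemma 4.4,
  bound on `F₂` (p. 12) [AizenmanDuminilCopinAnnals2021].
* M. Aizenman, H. Duminil-Copin, V. Sidoravicius, Comm. Math. Phys. 334 (2015), Lemma 2.2
  [AizenmanDuminilCopinSidoraviciusCMP2015] — through `WeightedCurrentsSwitching.lean`.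
-/

noncomputable section

open Finset
open scoped symmDiff ENNReal

namespace Literature.Probability.LatticeModels

variable {V : Type*} [Fintype V] [DecidableEq V] {G : SimpleGraph V} [DecidableRel G.Adj]
variable (G₁ : SimpleGraph V) [DecidableRel G₁.Adj] {K : G.edgeFinset → ℝ}

/-! ### Griffiths for subgraph-supported current sums -/

/-- The subgraph-supported sum is the sum for the couplings switched off outside `E(G₁)`:
`Z_{G₁}[A] = Z_{K off {e ∉ E(G₁)}}[A]`. [folklore] -/
theorem ecurrentSumIn_eq_ecurrentSum_koff (A : Finset V) :
    ecurrentSumIn G₁ K A =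
      ecurrentSum (koff K (univ.filter fun e : G.edgeFinset => (e : Sym2 V) ∉ G₁.edgeFinset)) A := by
  rw [ecurrentSum_koff]
  unfold ecurrentSumIn
  refine tsum_congr fun n => ?_
  have hiff : Current.IsSupp G₁ n ↔
      ∀ e, e ∈ (univ.filter fun e : G.edgeFinset => (e : Sym2 V) ∉ G₁.edgeFinset) → n e = 0 := by
    unfold Current.IsSupp
    simp only [mem_filter, mem_univ, true_and]
  by_cases h : Current.IsSupp G₁ n ∧ n.sources = A
  · rw [if_pos h, if_pos ⟨hiff.1 h.1, h.2⟩]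
  · rw [if_neg h, if_neg (fun h' => h ⟨hiff.2 h'.1, h'.2⟩)]

/-- **Griffiths' inequality for the depleted graph** ("The Griffiths inequality [Gri67] implies that
this probability is bounded by `⟨σ_vσ_w⟩²`"): `Z_{G₁}[A] · Z[∅] ≤ Z[A] · Z_{G₁}[∅]`, i.e. `⟨σ_A⟩' ≤ ⟨σ_A⟩`
for the model with the couplings off `E(G₁)` switched off (`K ≥ 0`).
[cite: AizenmanDuminilCopinAnnals2021, arXiv:1912.07973 §4.2, proof of Lemma 4.4, bound on F₂ (p. 12)] -/
theorem ecurrentSumIn_mul_ecurrentSum_empty_le (hK : ∀ e, 0 ≤ K e) (A : Finset V) :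
    ecurrentSumIn G₁ K A * ecurrentSum K ∅ ≤ ecurrentSum K A * ecurrentSumIn G₁ K ∅ := by
  rw [ecurrentSumIn_eq_ecurrentSum_koff, ecurrentSumIn_eq_ecurrentSum_koff]
  set D := (univ.filter fun e : G.edgeFinset => (e : Sym2 V) ∉ G₁.edgeFinset) with hD
  have hK' : ∀ e, 0 ≤ koff K D e := koff_nonneg hK D
  have hle : ∀ e, koff K D e ≤ K e := fun e => by
    unfold koff; split_ifs; exacts [hK e, le_rfl]
  rw [ecurrentSum_eq_ofReal hK', ecurrentSum_eq_ofReal hK, ecurrentSum_eq_ofReal hK, ecurrentSum_eq_ofReal hK',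
    ← ENNReal.ofReal_mul (wcurrentSum_nonneg hK' A), ← ENNReal.ofReal_mul (wcurrentSum_nonneg hK A)]
  exact ENNReal.ofReal_le_ofReal (wcurrentSum_mul_le_of_le hK' hle A)

namespace Current

/-- A current of `G` is supported on `G` with the bonds `D` deleted iff it vanishes on `D` (the
depleted graph of a backbone: `D` the bonds used by the walk). [folklore] -/
theorem isSupp_deleteEdges_iff' (D : Finset G.edgeFinset) (n : Current G) :
    IsSupp (G.deleteEdges ↑(D.image fun e : G.edgeFinset => (e : Sym2 V))) n ↔ ∀ e ∈ D, n e = 0 := by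
  have key : ∀ e : G.edgeFinset,
      ((e : Sym2 V) ∉ (G.deleteEdges ↑(D.image fun e : G.edgeFinset => (e : Sym2 V))).edgeFinset ↔ e ∈ D) := by
    intro e
    rw [SimpleGraph.mem_edgeFinset, SimpleGraph.edgeSet_deleteEdges, Set.mem_sdiff, Finset.mem_coe,
      Finset.mem_image]
    have he : (e : Sym2 V) ∈ G.edgeSet := SimpleGraph.mem_edgeFinset.1 e.2
    constructor
    · intro h
      by_contra hD
      exact h ⟨he, fun ⟨e', he', hee'⟩ => hD (Subtype.ext hee' ▸ he')⟩
    · rintro hD ⟨-, h2⟩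
      exact h2 ⟨e, hD, rfl⟩
  unfold IsSupp
  exact ⟨fun h e he => h e ((key e).2 he), fun h e he => h e ((key e).1 he)⟩

/-! ### The identity and the bound -/

/-- **`P^{∅}_{G₁} ⊗ P^{∅}_G[x ↔ y in G₁] = ⟨σ_xσ_y⟩'⟨σ_xσ_y⟩`** ("the switching lemma concerns one current
with depletion and one without"), current-sum form:
`∑ 1{n₁ ⊆ E(G₁), ∂n₁ = ∅} 1{∂n₂ = ∅} w w 𝟙[x ↔ y in E(G₁) through n₁+n₂] = Z_{G₁}[{x}Δ{y}] · Z[{x}Δ{y}]`.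
[cite: AizenmanDuminilCopinAnnals2021, arXiv:1912.07973 §4.2, proof of Lemma 4.4, bound on F₂ (p. 12)] -/
theorem tsum_isSupp_empty_empty_connIn_eq (hK : ∀ e, 0 ≤ K e) (x y : V) :
    ∑' p : Current G × Current G,
        (if IsSupp G₁ p.1 ∧ p.1.sources = ∅ then p.1.eweight K else 0) *
          (if p.2.sources = ∅ then p.2.eweight K else 0) * (connIn G₁ x y).indicator 1 (p.1 + p.2) =
      ecurrentSumIn G₁ K ({x} ∆ {y}) * ecurrentSum K ({x} ∆ {y}) := by
  have h := etsum_switching_univ G₁ hK ∅ ∅ x y (fun _ => 1)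
  simp only [one_mul, empty_symmDiff] at h
  rw [h, ecurrentSumIn_mul_ecurrentSum]
  refine tsum_congr fun p => ?_
  by_cases h1 : IsSupp G₁ p.1 ∧ p.1.sources = {x} ∆ {y}
  · have hconn : p.1 + p.2 ∈ connIn G₁ x y := add_mem_connIn_of_sources_eq G₁ h1.1 h1.2 p.2
    rw [Set.indicator_of_mem hconn, Pi.one_apply, mul_one]
  · rw [if_neg h1]; simp

/-- **`P^{∅}_{G₁} ⊗ P^{∅}_G[x ↔ y in G₁] ≤ ⟨σ_xσ_y⟩²`** (Aizenman–Duminil-Copin 2021, bound on `F₂`: "bounded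
by `⟨σ_vσ_w⟩⟨σ_vσ_w⟩'` … The Griffiths inequality implies that this probability is bounded by `⟨σ_vσ_w⟩²`"),
current-sum form: `(∑ 1{n₁ ⊆ E(G₁), ∂n₁=∅}1{∂n₂=∅} w w 𝟙[x ↔ y in E(G₁)]) · Z[∅] ≤ Z[{x}Δ{y}]² · Z_{G₁}[∅]`.
[cite: AizenmanDuminilCopinAnnals2021, arXiv:1912.07973 §4.2, proof of Lemma 4.4, bound on F₂ (p. 12)] -/
theorem tsum_isSupp_empty_empty_connIn_mul_le (hK : ∀ e, 0 ≤ K e) (x y : V) :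
    (∑' p : Current G × Current G,
        (if IsSupp G₁ p.1 ∧ p.1.sources = ∅ then p.1.eweight K else 0) *
          (if p.2.sources = ∅ then p.2.eweight K else 0) * (connIn G₁ x y).indicator 1 (p.1 + p.2)) *
        ecurrentSum K ∅ ≤
      ecurrentSum K ({x} ∆ {y}) ^ 2 * ecurrentSumIn G₁ K ∅ := by
  rw [tsum_isSupp_empty_empty_connIn_eq G₁ hK]
  calc ecurrentSumIn G₁ K ({x} ∆ {y}) * ecurrentSum K ({x} ∆ {y}) * ecurrentSum K ∅
      = ecurrentSum K ({x} ∆ {y}) * (ecurrentSumIn G₁ K ({x} ∆ {y}) * ecurrentSum K ∅) := by ring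
    _ ≤ ecurrentSum K ({x} ∆ {y}) * (ecurrentSum K ({x} ∆ {y}) * ecurrentSumIn G₁ K ∅) :=
        mul_le_mul' le_rfl (ecurrentSumIn_mul_ecurrentSum_empty_le G₁ hK _)
    _ = ecurrentSum K ({x} ∆ {y}) ^ 2 * ecurrentSumIn G₁ K ∅ := by ring

open scoped Classical in
/-- The indicator of "`A` is connected to `B` through `E(G₁)` in the total current": `𝟙[∃ a ∈ A, b ∈ B, a ↔ b in E(G₁)]`
(for `A = ∂Λ_n`, `B = ∂Λ_m`: "some `v ∈ ∂Λ_n` and `w ∈ ∂Λ_m` are connected in `ℤ⁴ ∖ Γ(n₁)`").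
[cite: AizenmanDuminilCopinAnnals2021, arXiv:1912.07973 §4.2, proof of Lemma 4.4 (event F₂) (p. 12)] -/
def crossInInd (A B : Finset V) (m : Current G) : ℝ≥0∞ :=
  if ∃ a ∈ A, ∃ b ∈ B, m ∈ connIn G₁ a b then 1 else 0

omit [DecidableEq V] [DecidableRel G₁.Adj] in
/-- Union bound: `𝟙[A ↔ B in G₁] ≤ ∑_{a,b} 𝟙[a ↔ b in G₁]`. [folklore] -/
theorem crossInInd_le_sum (A B : Finset V) (m : Current G) :
    crossInInd G₁ A B m ≤ ∑ a ∈ A, ∑ b ∈ B, (connIn G₁ a b).indicator (1 : Current G → ℝ≥0∞) m := by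
  classical
  unfold crossInInd
  split_ifs with h
  · obtain ⟨a, ha, b, hb, hab⟩ := h
    calc (1 : ℝ≥0∞) = (connIn G₁ a b).indicator (1 : Current G → ℝ≥0∞) m := by
          rw [Set.indicator_of_mem hab, Pi.one_apply]
      _ ≤ ∑ b' ∈ B, (connIn G₁ a b').indicator (1 : Current G → ℝ≥0∞) m :=
          Finset.single_le_sum (f := fun b' => (connIn G₁ a b').indicator (1 : Current G → ℝ≥0∞) m)
            (fun _ _ => bot_le) hb
      _ ≤ ∑ a' ∈ A, ∑ b' ∈ B, (connIn G₁ a' b').indicator (1 : Current G → ℝ≥0∞) m :=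
          Finset.single_le_sum (f := fun a' => ∑ b' ∈ B, (connIn G₁ a' b').indicator (1 : Current G → ℝ≥0∞) m)
            (fun _ _ => bot_le) ha
  · exact bot_le

/-- **`P^{∅}_{G₁} ⊗ P^{∅}_G[A ↔ B in G₁] ≤ ∑_{a ∈ A, b ∈ B} ⟨σ_aσ_b⟩²`** (the display
"`P^{0x,∅}[F₂] ≤ ∑_{v ∈ ∂Λ_n, w ∈ ∂Λ_m} ⟨σ_vσ_w⟩²`" after conditioning on the backbone), current-sum form:
`(∑ 1{n₁ ⊆ E(G₁), ∂n₁=∅}1{∂n₂=∅} w w 𝟙[A ↔ B in E(G₁)]) · Z[∅] ≤ (∑_{a,b} Z[{a}Δ{b}]²) · Z_{G₁}[∅]`.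
[cite: AizenmanDuminilCopinAnnals2021, arXiv:1912.07973 §4.2, proof of Lemma 4.4, display bounding P[F₂] (p. 12)] -/
theorem tsum_isSupp_empty_empty_crossIn_mul_le (hK : ∀ e, 0 ≤ K e) (A B : Finset V) :
    (∑' p : Current G × Current G,
        (if IsSupp G₁ p.1 ∧ p.1.sources = ∅ then p.1.eweight K else 0) *
          (if p.2.sources = ∅ then p.2.eweight K else 0) * crossInInd G₁ A B (p.1 + p.2)) * ecurrentSum K ∅ ≤
      (∑ a ∈ A, ∑ b ∈ B, ecurrentSum K ({a} ∆ {b}) ^ 2) * ecurrentSumIn G₁ K ∅ := by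
  set W : Current G × Current G → ℝ≥0∞ := fun p =>
    (if IsSupp G₁ p.1 ∧ p.1.sources = ∅ then p.1.eweight K else 0) *
      (if p.2.sources = ∅ then p.2.eweight K else 0) with hW
  calc (∑' p : Current G × Current G, W p * crossInInd G₁ A B (p.1 + p.2)) * ecurrentSum K ∅
      ≤ (∑' p : Current G × Current G, W p *
          ∑ a ∈ A, ∑ b ∈ B, (connIn G₁ a b).indicator (1 : Current G → ℝ≥0∞) (p.1 + p.2)) * ecurrentSum K ∅ :=
        mul_le_mul' (ENNReal.tsum_le_tsum fun p => mul_le_mul' le_rfl (crossInInd_le_sum G₁ A B _)) le_rfl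
    _ = (∑ a ∈ A, ∑ b ∈ B, ∑' p : Current G × Current G,
          W p * (connIn G₁ a b).indicator (1 : Current G → ℝ≥0∞) (p.1 + p.2)) * ecurrentSum K ∅ := by
        congr 1
        simp_rw [Finset.mul_sum]
        rw [Summable.tsum_finsetSum (fun _ _ => ENNReal.summable)]
        refine Finset.sum_congr rfl fun a _ => ?_
        rw [Summable.tsum_finsetSum (fun _ _ => ENNReal.summable)]
    _ = ∑ a ∈ A, ∑ b ∈ B, (∑' p : Current G × Current G,
          W p * (connIn G₁ a b).indicator (1 : Current G → ℝ≥0∞) (p.1 + p.2)) * ecurrentSum K ∅ := by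
        rw [Finset.sum_mul]; simp_rw [Finset.sum_mul]
    _ ≤ ∑ a ∈ A, ∑ b ∈ B, ecurrentSum K ({a} ∆ {b}) ^ 2 * ecurrentSumIn G₁ K ∅ :=
        Finset.sum_le_sum fun a _ => Finset.sum_le_sum fun b _ =>
          tsum_isSupp_empty_empty_connIn_mul_le G₁ hK a b
    _ = (∑ a ∈ A, ∑ b ∈ B, ecurrentSum K ({a} ∆ {b}) ^ 2) * ecurrentSumIn G₁ K ∅ := by
        rw [Finset.sum_mul]; simp_rw [Finset.sum_mul]

end Current

end Literature.Probability.LatticeModels
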